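import Literature.AnabelianGeometry.AbsoluteAnabelian.LocalUnramifiedQuotientH2Index
import Literature.NumberTheory.GaloisRepresentations.ContinuousCohomologyIntInfRes
import HarnessLib

/-!
# Unramified classes of `H²(Γ_F, ℤ)`: inflation from `Gal(F^nr/F)`, the invariant `χ_c(Frob)`,
# and the index formula `χ_{res c}(Frob_E) = f • χ_c(Frob_F)` on `Γ`-level

abc-iut cell, layer L4.  PROOF file (no definition, no named fact).  For a non-archimedean local field
`F` with absolute Galois group `Γ_F`, a class `c ∈ H²(Γ_F, ℤ)` with character
`χ_c = H2IntEquivHom Γ_F c : Γ_F → ℚ/ℤ` (trunk, inverse Bockstein) is UNRAMIFIED when `χ_c` kills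
`Gal(F̄/F^nr) = galUnr F` (the inertia group).  Using the trunk's naturality / inflation–restriction
for `ℤ`-coefficients (`ContinuousCohomologyIntInfRes.lean`):

* `character_apply_eq_of_mk_eq` — a character killing a normal subgroup is constant on its cosets;
  `character_apply_eq_zsmul_of_isFrobPow` — an unramified character takes the value `n • χ(Frob)` at
  every Frobenius power of exponent `n` (any lift);
* `unramified_iff_exists_inf` — **`c` is unramified iff it is inflated from `H²(Gal(F^nr/F), ℤ)`**,
  and `H2IntEquivHom_inf_apply_eq_H2UnrEquivQModZ` — the value `χ_{inf c₀}(Frob)` is the invariant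
  `H2UnrEquivQModZ c₀ ∈ ℚ/ℤ` of `LocalUnramifiedQuotientH2.lean`;
* `H2Int_character_apply_eq_of_isFrobPow_one` — independence of the Frobenius lift;
* **`H2Int_character_res_apply_frob` — `χ_{res c}(Frob_E) = f • χ_c(Frob_F)`** for an extension
  `E/F` with `q_E = q_F ^ f` and `c` unramified (`res` along `Γ_E → Γ_F`), with
  `res_unramified` — restriction preserves unramified classes.  This is the `Γ`-level form of the
  index formula `inv_E ∘ res = f • inv_F` of `LocalUnramifiedQuotientH2Index.lean` (there on the
  unramified quotients), i.e. of Serre, *Local Fields* XIII §3 Prop. 7 restricted to `ℤ`-coefficients /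
  [AbsTopIII] Rmk. 3.2.2 «dividing by the index».

HONEST FRAMING: classical; nothing here bears on [IUTchIII] Cor. 3.12 or takes a side.
-/

noncomputable section

open CategoryTheory Function
open Field IsNonarchimedeanLocalField ValuativeRel

universe u

namespace Literature.AnabelianGeometry.AbsoluteAnabelian

open Literature.NumberTheory.GaloisRepresentations
open Literature.NumberTheory.GaloisRepresentations.IsNonarchimedeanLocalField
open _root_.TopRep _root_.ContRepresentation _root_.ContinuousCohomology _root_.Topology

section Group

variable {G : Type u} [Group G] [TopologicalSpace G]
variable {A : Type u} [AddCommGroup A] [TopologicalSpace A] [DiscreteTopology A]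

/-- A continuous character killing a normal subgroup `N` is constant on the cosets of `N`.
[cite: SerreLocalFields1979, XIII §1] -/
theorem character_apply_eq_of_mk_eq (N : Subgroup G) [N.Normal]
    (χ : contOneCocycles (ContinuousRep.trivial G ℤ A).toTopRep) (hχ : ∀ n ∈ N, χ.1 n = 0)
    {σ τ : G} (h : (QuotientGroup.mk σ : G ⧸ N) = QuotientGroup.mk τ) : χ.1 σ = χ.1 τ := by
  rw [QuotientGroup.eq] at h
  have h0 := hχ _ h
  rw [contOneCocycles.apply_mul_of_trivial (fun _ _ => rfl), contOneCocycles.apply_inv] at h0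
  change -(χ.1 σ) + χ.1 τ = 0 at h0
  exact (neg_add_eq_zero.mp h0)

end Group

variable (F : Type u) [Field F] [ValuativeRel F] [TopologicalSpace F] [IsNonarchimedeanLocalField F]
variable {A : Type u} [AddCommGroup A] [TopologicalSpace A] [DiscreteTopology A]
-- `CompactSpace Γ_F` is the tree's theorem `absoluteGaloisGroup_compactSpace F` (not an instance);
-- the `H²` statements below take it as an instance hypothesis (`haveI := absoluteGaloisGroup_compactSpace F`).

variable {F} in
/-- **An unramified character takes the value `n • χ(φ)` at every Frobenius power of exponent `n`**,
`φ` any arithmetic Frobenius lift (`IsFrobPow φ 1`): two Frobenius powers of the same exponent are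
congruent modulo inertia. [cite: SerreLocalFields1979, XIII §1] -/
theorem character_apply_eq_zsmul_of_isFrobPow
    (χ : contOneCocycles (ContinuousRep.trivial (absoluteGaloisGroup F) ℤ A).toTopRep)
    (hχ : ∀ σ ∈ galUnr F, χ.1 σ = 0) {φ σ : absoluteGaloisGroup F} (hφ : IsFrobPow φ 1) {n : ℤ}
    (hσ : IsFrobPow σ n) : χ.1 σ = n • χ.1 φ := by
  have hφn : IsFrobPow (φ ^ n) n := by
    have h := hφ.zpow n
    rwa [mul_one] at h
  rw [character_apply_eq_of_mk_eq (galUnr F) χ hχ (mk_eq_mk_of_isFrobPow hσ hφn),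
    contOneCocycles.apply_zpow_of_trivial (fun _ _ => rfl)]

variable {F} in
/-- Independence of the lift: an unramified character takes the same value at all arithmetic
Frobenius lifts. [cite: SerreLocalFields1979, XIII §1] -/
theorem character_apply_eq_of_isFrobPow_one
    (χ : contOneCocycles (ContinuousRep.trivial (absoluteGaloisGroup F) ℤ A).toTopRep)
    (hχ : ∀ σ ∈ galUnr F, χ.1 σ = 0) {φ φ' : absoluteGaloisGroup F} (hφ : IsFrobPow φ 1)
    (hφ' : IsFrobPow φ' 1) : χ.1 φ = χ.1 φ' :=
  character_apply_eq_of_mk_eq (galUnr F) χ hχ (mk_eq_mk_of_isFrobPow hφ hφ')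

/-! ### Unramified classes of `H²(Γ_F, ℤ)` -/

variable [CompactSpace (absoluteGaloisGroup F)]

/-- **A class of `H²(Γ_F, ℤ)` is unramified (its character kills `Gal(F̄/F^nr)`) iff it is inflated
from `H²(Gal(F^nr/F), ℤ)`.** [cite: SerreGaloisCohomology1997, I §2.6 (b)] -/
theorem unramified_iff_exists_inf
    (c : continuousCohomology 2
      (ContinuousRep.trivial (absoluteGaloisGroup F) ℤ ZCoeff.{u}).toTopRep) :
    (∀ σ ∈ galUnr F, (H2IntEquivHom (absoluteGaloisGroup F) c).1 σ = 0) ↔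
      ∃ c₀ : continuousCohomology 2
          (ContinuousRep.trivial (absoluteGaloisGroup F ⧸ galUnr F) ℤ ZCoeff.{u}).toTopRep,
        pullH (ContinuousMonoidHom.quotientMk (galUnr F))
          (ContinuousRep.trivial (absoluteGaloisGroup F ⧸ galUnr F) ℤ ZCoeff.{u}) 2 c₀ = c :=
  (exists_inf_two_ZCoeff_eq_iff (galUnr F) c).symm

variable {F} in
/-- **`χ_{inf c₀}(φ) = inv(c₀)`**: the character of an inflated class evaluated at a Frobenius lift is
the invariant `H2UnrEquivQModZ c₀ ∈ ℚ/ℤ` of the class on the unramified quotient.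
[cite: SerreLocalFields1979, XIII §3] -/
theorem H2IntEquivHom_inf_apply_eq_H2UnrEquivQModZ {φ : absoluteGaloisGroup F} (hφ : IsFrobPow φ 1)
    (c₀ : continuousCohomology 2
      (ContinuousRep.trivial (absoluteGaloisGroup F ⧸ galUnr F) ℤ ZCoeff.{u}).toTopRep) :
    (H2IntEquivHom (absoluteGaloisGroup F) (pullH (ContinuousMonoidHom.quotientMk (galUnr F))
        (ContinuousRep.trivial (absoluteGaloisGroup F ⧸ galUnr F) ℤ ZCoeff.{u}) 2 c₀)).1 φ =
      H2UnrEquivQModZ hφ c₀ := by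
  rw [H2IntEquivHom_pullH_apply, H2UnrEquivQModZ_apply]
  rfl

variable {F} in
/-- **Independence of the Frobenius lift** for the character of an unramified class of `H²(Γ_F, ℤ)`.
[cite: SerreLocalFields1979, XIII §3] -/
theorem H2Int_character_apply_eq_of_isFrobPow_one
    (c : continuousCohomology 2
      (ContinuousRep.trivial (absoluteGaloisGroup F) ℤ ZCoeff.{u}).toTopRep)
    (hc : ∀ σ ∈ galUnr F, (H2IntEquivHom (absoluteGaloisGroup F) c).1 σ = 0)
    {φ φ' : absoluteGaloisGroup F} (hφ : IsFrobPow φ 1) (hφ' : IsFrobPow φ' 1) :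
    (H2IntEquivHom (absoluteGaloisGroup F) c).1 φ = (H2IntEquivHom (absoluteGaloisGroup F) c).1 φ' :=
  character_apply_eq_of_isFrobPow_one _ hc hφ hφ'

/-! ### Restriction along `Γ_E → Γ_F` -/

section Restrict

variable (E : Type u) [Field E] [ValuativeRel E] [TopologicalSpace E] [IsNonarchimedeanLocalField E]
  [Algebra F E] [CompactSpace (absoluteGaloisGroup E)]

variable {F E} in
/-- **Restriction preserves unramified classes**: if `χ_c` kills `Gal(F̄/F^nr)` then `χ_{res c}`
kills `Gal(Ē/E^nr)` (`res (Gal(Ē/E^nr)) ≤ Gal(F̄/F^nr)`). [cite: SerreLocalFields1979, XIII §3] -/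
theorem res_unramified
    (c : continuousCohomology 2
      (ContinuousRep.trivial (absoluteGaloisGroup F) ℤ ZCoeff.{u}).toTopRep)
    (hc : ∀ σ ∈ galUnr F, (H2IntEquivHom (absoluteGaloisGroup F) c).1 σ = 0) :
    ∀ τ ∈ galUnr E, (H2IntEquivHom (absoluteGaloisGroup E)
      (pullH (absGaloisRestrict F E) (ContinuousRep.trivial (absoluteGaloisGroup F) ℤ ZCoeff.{u})
        2 c)).1 τ = 0 := by
  intro τ hτ
  rw [H2IntEquivHom_pullH_apply]
  exact hc _ (galUnr_le_comap_absGaloisRestrict F E hτ)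

variable {F E} in
/-- **The index formula on `Γ`-level: `χ_{res c}(Frob_E) = f • χ_c(Frob_F)`** for an unramified
class `c ∈ H²(Γ_F, ℤ)`, arithmetic Frobenius lifts `φ_E`, `φ_F`, and `q_E = q_F ^ f`
(`res φ_E` is a Frobenius power of exponent `f` for `F`).
[cite: SerreLocalFields1979, XIII §3 Prop. 7] -/
theorem H2Int_character_res_apply_frob
    (c : continuousCohomology 2
      (ContinuousRep.trivial (absoluteGaloisGroup F) ℤ ZCoeff.{u}).toTopRep)
    (hc : ∀ σ ∈ galUnr F, (H2IntEquivHom (absoluteGaloisGroup F) c).1 σ = 0)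
    {φE : absoluteGaloisGroup E} {φF : absoluteGaloisGroup F} (hφE : IsFrobPow φE 1)
    (hφF : IsFrobPow φF 1) {f : ℕ} (hf : residueFieldCard E = residueFieldCard F ^ f) :
    (H2IntEquivHom (absoluteGaloisGroup E)
      (pullH (absGaloisRestrict F E) (ContinuousRep.trivial (absoluteGaloisGroup F) ℤ ZCoeff.{u})
        2 c)).1 φE =
      f • (H2IntEquivHom (absoluteGaloisGroup F) c).1 φF := by
  rw [H2IntEquivHom_pullH_apply]
  have h := IsFrobPow.absGaloisRestrict_holds F hφE f hf
  rw [mul_one] at h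
  rw [character_apply_eq_zsmul_of_isFrobPow _ hc hφF h, natCast_zsmul]

end Restrict

/-! ### The unramified part of `H²(Γ_F, ℤ)` is `ℚ/ℤ` through `χ_c(Frob)` -/

section UnramifiedPart

/-- **An unramified class with `χ_c(Frob) = 0` is zero**: `c = inf c₀` and `χ_c(φ) = inv(c₀)` with
`inv : H²(Gal(F^nr/F), ℤ) ⥲ ℚ/ℤ` an isomorphism. [cite: SerreLocalFields1979, XIII §3] -/
theorem H2Int_eq_zero_of_unramified_of_apply_frob_eq_zero
    (c : continuousCohomology 2
      (ContinuousRep.trivial (absoluteGaloisGroup F) ℤ ZCoeff.{u}).toTopRep)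
    (hc : ∀ σ ∈ galUnr F, (H2IntEquivHom (absoluteGaloisGroup F) c).1 σ = 0)
    {φ : absoluteGaloisGroup F} (hφ : IsFrobPow φ 1)
    (h0 : (H2IntEquivHom (absoluteGaloisGroup F) c).1 φ = 0) : c = 0 := by
  obtain ⟨c₀, rfl⟩ := (unramified_iff_exists_inf F c).mp hc
  rw [H2IntEquivHom_inf_apply_eq_H2UnrEquivQModZ hφ] at h0
  have hc₀ : c₀ = 0 := by
    apply (H2UnrEquivQModZ hφ).injective
    rw [h0, map_zero]
  rw [hc₀, map_zero]
  exact rfl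

/-- **Unramified classes are determined by `χ_c(Frob)`.** [cite: SerreLocalFields1979, XIII §3] -/
theorem H2Int_eq_of_unramified_of_apply_frob_eq
    (c c' : continuousCohomology 2
      (ContinuousRep.trivial (absoluteGaloisGroup F) ℤ ZCoeff.{u}).toTopRep)
    (hc : ∀ σ ∈ galUnr F, (H2IntEquivHom (absoluteGaloisGroup F) c).1 σ = 0)
    (hc' : ∀ σ ∈ galUnr F, (H2IntEquivHom (absoluteGaloisGroup F) c').1 σ = 0)
    {φ : absoluteGaloisGroup F} (hφ : IsFrobPow φ 1)
    (h : (H2IntEquivHom (absoluteGaloisGroup F) c).1 φ =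
      (H2IntEquivHom (absoluteGaloisGroup F) c').1 φ) : c = c' := by
  rw [← sub_eq_zero]
  refine H2Int_eq_zero_of_unramified_of_apply_frob_eq_zero F (c - c') (fun σ hσ => ?_) hφ ?_
  · rw [map_sub]
    change (H2IntEquivHom (absoluteGaloisGroup F) c).1 σ -
      (H2IntEquivHom (absoluteGaloisGroup F) c').1 σ = 0
    rw [hc σ hσ, hc' σ hσ, sub_zero]
  · rw [map_sub]
    change (H2IntEquivHom (absoluteGaloisGroup F) c).1 φ -
      (H2IntEquivHom (absoluteGaloisGroup F) c').1 φ = 0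
    rw [h, sub_self]

/-- **Every `x ∈ ℚ/ℤ` is `χ_c(Frob)` for a (unique) unramified class `c ∈ H²(Γ_F, ℤ)`**: inflate
`inv⁻¹(x) ∈ H²(Gal(F^nr/F), ℤ)`.  With the two previous statements: the unramified part of
`H²(Γ_F, ℤ)` maps isomorphically onto `ℚ/ℤ` by `c ↦ χ_c(Frob)` — the `ℤ`-coefficient shadow of
`Br(F^nr/F) ⥲ ℚ/ℤ`. [cite: SerreLocalFields1979, XIII §3] -/
theorem exists_unramified_H2Int_apply_frob_eq {φ : absoluteGaloisGroup F} (hφ : IsFrobPow φ 1)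
    (x : QModZCoeff.{u}) :
    ∃ c : continuousCohomology 2
        (ContinuousRep.trivial (absoluteGaloisGroup F) ℤ ZCoeff.{u}).toTopRep,
      (∀ σ ∈ galUnr F, (H2IntEquivHom (absoluteGaloisGroup F) c).1 σ = 0) ∧
        (H2IntEquivHom (absoluteGaloisGroup F) c).1 φ = x := by
  refine ⟨pullH (ContinuousMonoidHom.quotientMk (galUnr F))
      (ContinuousRep.trivial (absoluteGaloisGroup F ⧸ galUnr F) ℤ ZCoeff.{u}) 2
      ((H2UnrEquivQModZ hφ).symm x), ?_, ?_⟩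
  · exact (unramified_iff_exists_inf F _).mpr ⟨_, rfl⟩
  · rw [H2IntEquivHom_inf_apply_eq_H2UnrEquivQModZ hφ, LinearEquiv.apply_symm_apply]

end UnramifiedPart

/-! ### Transport under isomorphisms of absolute Galois groups ([AbsAnab] Prop. 1.2.1 (vii), `Γ`-level) -/

section Transport

variable {K₁ K₂ : Type u} [Field K₁] [ValuativeRel K₁] [TopologicalSpace K₁]
  [IsNonarchimedeanLocalField K₁] [Field K₂] [ValuativeRel K₂] [TopologicalSpace K₂]
  [IsNonarchimedeanLocalField K₂]
  [CompactSpace (absoluteGaloisGroup K₁)] [CompactSpace (absoluteGaloisGroup K₂)]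

/-- Pull-back along an isomorphism `α : Γ_{K₁} ≃ Γ_{K₂}` carrying inertia into inertia preserves
unramified classes of `H²(·, ℤ)`. [cite: MochizukiAbsAnab2004, Prop 1.2.1 (vii) p.11] -/
theorem pullH_equiv_unramified (α : absoluteGaloisGroup K₁ ≃ₜ* absoluteGaloisGroup K₂)
    (hI : ∀ σ ∈ galUnr K₁, α σ ∈ galUnr K₂)
    (c : continuousCohomology 2
      (ContinuousRep.trivial (absoluteGaloisGroup K₂) ℤ ZCoeff.{u}).toTopRep)
    (hc : ∀ τ ∈ galUnr K₂, (H2IntEquivHom (absoluteGaloisGroup K₂) c).1 τ = 0) :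
    ∀ σ ∈ galUnr K₁, (H2IntEquivHom (absoluteGaloisGroup K₁)
      (pullH (⟨α.toMonoidHom, α.continuous⟩ : absoluteGaloisGroup K₁ →ₜ* absoluteGaloisGroup K₂)
        (ContinuousRep.trivial (absoluteGaloisGroup K₂) ℤ ZCoeff.{u}) 2 c)).1 σ = 0 := by
  intro σ hσ
  rw [H2IntEquivHom_pullH_apply]
  exact hc _ (hI σ hσ)

/-- **[AbsAnab] Prop. 1.2.1 (vii) on `Γ`-level for `ℤ`-coefficients**: if `α : Γ_{K₁} ≃ Γ_{K₂}`
carries inertia into inertia ((ii)) and some arithmetic Frobenius to an arithmetic Frobenius ((iv)),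
then for every UNRAMIFIED class `c ∈ H²(Γ_{K₂}, ℤ)` the invariants agree:
`χ_{α^* c}(φ₁) = χ_c(φ₂)` for ANY Frobenius lifts `φ₁` of `K₁`, `φ₂` of `K₂`.
[cite: MochizukiAbsAnab2004, Prop 1.2.1 (vii) p.11] -/
theorem H2Int_character_pullH_equiv_apply_frob
    (α : absoluteGaloisGroup K₁ ≃ₜ* absoluteGaloisGroup K₂)
    (hI : ∀ σ ∈ galUnr K₁, α σ ∈ galUnr K₂)
    (hF : ∃ ψ : absoluteGaloisGroup K₁, IsFrobPow ψ 1 ∧ IsFrobPow (α ψ) 1)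
    (c : continuousCohomology 2
      (ContinuousRep.trivial (absoluteGaloisGroup K₂) ℤ ZCoeff.{u}).toTopRep)
    (hc : ∀ τ ∈ galUnr K₂, (H2IntEquivHom (absoluteGaloisGroup K₂) c).1 τ = 0)
    {φ₁ : absoluteGaloisGroup K₁} {φ₂ : absoluteGaloisGroup K₂} (hφ₁ : IsFrobPow φ₁ 1)
    (hφ₂ : IsFrobPow φ₂ 1) :
    (H2IntEquivHom (absoluteGaloisGroup K₁)
      (pullH (⟨α.toMonoidHom, α.continuous⟩ : absoluteGaloisGroup K₁ →ₜ* absoluteGaloisGroup K₂)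
        (ContinuousRep.trivial (absoluteGaloisGroup K₂) ℤ ZCoeff.{u}) 2 c)).1 φ₁ =
      (H2IntEquivHom (absoluteGaloisGroup K₂) c).1 φ₂ := by
  obtain ⟨ψ, hψ, hαψ⟩ := hF
  have hunr := pullH_equiv_unramified α hI c hc
  rw [character_apply_eq_of_isFrobPow_one _ hunr hφ₁ hψ, H2IntEquivHom_pullH_apply,
    character_apply_eq_of_isFrobPow_one _ hc hφ₂ hαψ]
  rfl

end Transport

end Literature.AnabelianGeometry.AbsoluteAnabelian

end
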